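import Mathlib.Data.ZMod.Basic
import Mathlib.LinearAlgebra.Dimension.StrongRankCondition
import Mathlib.LinearAlgebra.FreeModule.Basic
import Literature.NumberTheory.GaloisRepresentations.ContinuousRepCoeffExtension
import HarnessLib

/-!
# `A ⊗_ℤ M` is free of rank `r` over `A` when `M ≅ (ℤ/n)^r` and `n = 0` in `A`
# (Howard's hypothesis H.0 «`T` is a free `R`-module of rank two» for the specialised modules
# `E[p^k] ⊗ A_{m,k}(ψ)`; proved theorems + one explicit basis, Mathlib-only algebra)

Topic `NumberTheory/GaloisRepresentations` (companion of `ContinuousRepCoeffExtension`, whose carrier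
`CoeffExtension ℤ A M = A ⊗[ℤ] M` is the underlying module of the tree's coefficient-extended discrete
Galois modules — in particular of `IwasawaAlgebra.EisensteinCoeff.Twisted p m k M`, Howard's
`T_𝔮/p^k T_𝔮 = E[p^k] ⊗ Λ/(q_m, p^k)(ψ)` of cell `pub/bsd-print-x9`).

B. Howard, *The Heegner point Kolyvagin system*, Compositio Math. 140 (2004), hypothesis **H.0** of §1.3
(arXiv:1202.6340, §2.3): «`T` is a free `R`-module of rank two». For the specialised triple at the
Eisenstein prime `𝔮 = (T^m + p)` the finite levels are `T_𝔮/p^k = E[p^k] ⊗_ℤ A_{m,k}` with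
`A_{m,k} = Λ/(q_m, p^k)`, a ring in which `p^k = 0`, and `E[p^k] ≅ (ℤ/p^k)²` as a group (Silverman,
*AEC*, Cor. III.6.4(b)). The freeness is the following piece of [folklore] linear algebra, recorded here
for an arbitrary commutative ring `A`, an arbitrary finite index type `ι` and an arbitrary modulus `n`:

* `CoeffExtension.coordOfAddEquiv hn e : CoeffExtension ℤ A M →ₗ[A] (ι → A)`,
  `a ⊗ x ↦ (a · e(x)_i)_i`, and `CoeffExtension.coordEquivOfAddEquiv hn e : CoeffExtension ℤ A M ≃ₗ[A] (ι → A)`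
  for an additive isomorphism `e : M ≃+ (ι → ZMod n)`, with inverse `c ↦ ∑ i, c i • (1 ⊗ e⁻¹(δ_i))`;
* **`CoeffExtension.basisOfAddEquiv hn e : Module.Basis ι A (CoeffExtension ℤ A M)`**, the basis
  `i ↦ 1 ⊗ e⁻¹(δ_i)` (`basisOfAddEquiv_apply`), with coordinates `repr (a ⊗ x) i = a · e(x)_i`
  (`basisOfAddEquiv_repr_tmul`);
* consequences: `free_of_addEquiv`, `moduleFinite_of_addEquiv`, **`finrank_eq_card_of_addEquiv`**
  (`finrank_A (A ⊗ M) = |ι|` for `A` non-trivial), `natCard_eq_pow_of_addEquiv` (`#(A ⊗ M) = #A^|ι|`),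
  `finite_of_addEquiv`.

Proof: `A ⊗_ℤ (ℤ/n)^ι ≅ (A ⊗_ℤ ℤ/n)^ι ≅ (A/nA)^ι = A^ι`, written out on pure tensors: the coordinate
map loses nothing because `x = ∑ i (e(x)_i)~ • e⁻¹(δ_i)` for any integer lifts `(e(x)_i)~`, and integer
scalars move through `⊗_ℤ`. Nothing here is specific to elliptic curves or to Iwasawa algebras; the
instantiation `A = A_{m,k}`, `M = E[p^k]`, `ι = Fin 2` (H.0 verbatim: `Module.Free ∧ finrank = 2`) is in
`Literature/NumberTheory/EllipticCurves/ZpExtensionEisensteinTwistFreeProofs`. No named fact, no `sorry`,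
no instance, no notation. BSD is not proved by any of this.

References: [BourbakiAlgebre1a3] N. Bourbaki, *Algebra I (Ch. 1–3)*, Ch. II §3 no. 6 Cor. 2–3 to Prop. 6
(`(ℤ/n) ⊗_ℤ F = F/nF`; `E ⊗_A F = (E/𝔞E) ⊗_{A/𝔞} F` when `𝔞` kills `F`) and Ch. II §5 no. 1 Prop. 4 (base
change of a free module is free on `1 ⊗ a_λ`); [Howard2004HeegnerKolyvagin] §1.3 hypothesis H.0
(arXiv:1202.6340 p0007); [SilvermanAEC2009] Cor. III.6.4(b).
-/

noncomputable section

open scoped TensorProduct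

namespace Literature.NumberTheory.GaloisRepresentations

namespace CoeffExtension

section Coord

variable {A : Type*} [CommRing A] {n : ℕ} {ι : Type*} {M : Type*} [AddCommGroup M]

/-! ## The cast `ℤ/n → A` when `n = 0` in `A`, and three identities in `A ⊗_ℤ M` -/

/-- The canonical ring map `ℤ/n → A` of a ring `A` in which `n = 0` (Mathlib `ZMod.castHom` along
`ringChar A ∣ n`); private plumbing, statements below use `ZMod.cast`. [folklore] -/
private def zmodCastHom (hn : (n : A) = 0) : ZMod n →+* A :=
  ZMod.castHom ((ringChar.spec A n).1 hn) A

/-- `zmodCastHom` is `ZMod.cast`. [folklore] -/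
private theorem zmodCastHom_apply (hn : (n : A) = 0) (x : ZMod n) : zmodCastHom hn x = (ZMod.cast x : A) :=
  rfl

/-- `tmul c` is additive in the second variable, as a bundled map `M →+ A ⊗_ℤ M`. [folklore] -/
private def tmulRight (c : A) : M →+ CoeffExtension ℤ A M where
  toFun a := tmul c a
  map_zero' := by
    change (c ⊗ₜ[ℤ] (0 : M) : A ⊗[ℤ] M) = 0
    exact TensorProduct.tmul_zero M c
  map_add' a b := by
    change (c ⊗ₜ[ℤ] (a + b) : A ⊗[ℤ] M) = c ⊗ₜ[ℤ] a + c ⊗ₜ[ℤ] b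
    exact TensorProduct.tmul_add c a b

/-- Unfolding `tmulRight`. [folklore] -/
@[simp] private theorem tmulRight_apply (c : A) (a : M) : tmulRight c a = (tmul c a : CoeffExtension ℤ A M) := rfl

/-- Integer scalars move through a pure tensor of `A ⊗_ℤ M`: `(z : A) • (c ⊗ a) = c ⊗ (z • a)`. [folklore] -/
private theorem intCast_smul_tmul (z : ℤ) (c : A) (a : M) :
    ((z : A) • (tmul c a : CoeffExtension ℤ A M)) = tmul c (z • a) := by
  rw [Int.cast_smul_eq_zsmul, ← tmulRight_apply, ← tmulRight_apply, map_zsmul]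

/-- `c • (1 ⊗ a) = c ⊗ a` in `A ⊗_ℤ M`. [folklore] -/
private theorem smul_tmul_one_eq (c : A) (a : M) : (c • (tmul 1 a : CoeffExtension ℤ A M)) = tmul c a := by
  change (c • ((1 : A) ⊗ₜ[ℤ] a) : A ⊗[ℤ] M) = c ⊗ₜ[ℤ] a
  rw [TensorProduct.smul_tmul', smul_eq_mul, mul_one]

/-! ## The coordinate map `A ⊗_ℤ M → A^ι` -/

/-- The bilinear map `(a, x) ↦ (a · e(x)_i)_i` underlying the coordinate map. [folklore] -/
private def coordBil (hn : (n : A) = 0) (e : M ≃+ (ι → ZMod n)) : A →ₗ[A] M →ₗ[ℤ] (ι → A) where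
  toFun a :=
    { toFun := fun x i => a * zmodCastHom hn (e x i)
      map_add' := fun x y => by
        ext i
        rw [Pi.add_apply, map_add, Pi.add_apply, map_add, mul_add]
      map_smul' := fun z x => by
        ext i
        simp only [RingHom.id_apply, Pi.smul_apply, map_zsmul, zsmul_eq_mul, map_mul, map_intCast]
        ring }
  map_add' a b := by
    ext x i
    change (a + b) * _ = a * _ + b * _
    rw [add_mul]
  map_smul' r a := by
    ext x i
    change (r • a) * _ = r • (a * _)
    rw [smul_eq_mul, smul_eq_mul, mul_assoc]

/-- **The coordinate map `A ⊗_ℤ M →ₗ[A] A^ι`, `a ⊗ x ↦ (a · e(x)_i)_i`** attached to `e : M ≃ (ℤ/n)^ι`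
(`(n : A) = 0`; `e(x)_i ∈ ℤ/n` read in `A` through `ZMod.cast`, a ring map since `n = 0` in `A`): the composite
`A ⊗_ℤ M = A ⊗_{ℤ/n} M ≅ A ⊗_{ℤ/n} (ℤ/n)^ι = A^ι`. [cite: BourbakiAlgebre1a3, Ch. II §3 no. 6 Cor. 3 to Prop. 6 (E ⊗_A F = (E/𝔞E) ⊗_{A/𝔞} F for 𝔞 ⊆ Ann F; Cor. 2: (ℤ/n) ⊗_ℤ F = F/nF)] [cite: BourbakiAlgebre1a3, Ch. II §5 no. 1 Prop. 4 (a basis (a_λ) of E gives the basis (1 ⊗ a_λ) of ρ^*(E) = B ⊗_A E)] -/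
def coordOfAddEquiv (hn : (n : A) = 0) (e : M ≃+ (ι → ZMod n)) : CoeffExtension ℤ A M →ₗ[A] (ι → A) :=
  (TensorProduct.AlgebraTensorModule.lift (coordBil hn e) : A ⊗[ℤ] M →ₗ[A] (ι → A))

/-- `coordOfAddEquiv` on pure tensors: `a ⊗ x ↦ (a · e(x)_i)_i`. [cite: BourbakiAlgebre1a3, Ch. II §3 no. 6 Cor. 3 to Prop. 6 (E ⊗_A F = (E/𝔞E) ⊗_{A/𝔞} F for 𝔞 ⊆ Ann F; Cor. 2: (ℤ/n) ⊗_ℤ F = F/nF)] -/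
@[simp]
theorem coordOfAddEquiv_tmul (hn : (n : A) = 0) (e : M ≃+ (ι → ZMod n)) (a : A) (x : M) (i : ι) :
    coordOfAddEquiv hn e (tmul a x) i = a * (ZMod.cast (e x i) : A) := by
  change (TensorProduct.AlgebraTensorModule.lift (coordBil hn e) : A ⊗[ℤ] M →ₗ[A] (ι → A)) (a ⊗ₜ[ℤ] x) i = _
  rw [TensorProduct.AlgebraTensorModule.lift_tmul]
  rfl

end Coord

section Vec

variable {A : Type*} [CommRing A] {n : ℕ} {ι : Type*} [DecidableEq ι] {M : Type*} [AddCommGroup M]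

/-! ## The basis vectors `1 ⊗ e⁻¹(δ_i)` -/

/-- **The vectors `1 ⊗ e⁻¹(δ_i) ∈ A ⊗_ℤ M`** (the basis of `basisOfAddEquiv`). [cite: BourbakiAlgebre1a3, Ch. II §5 no. 1 Prop. 4 (a basis (a_λ) of E gives the basis (1 ⊗ a_λ) of ρ^*(E) = B ⊗_A E)] -/
def stdVec (e : M ≃+ (ι → ZMod n)) (i : ι) : CoeffExtension ℤ A M :=
  tmul 1 (e.symm (Pi.single i (1 : ZMod n)))

/-- Unfolding `stdVec`. [folklore] -/
private theorem stdVec_def (e : M ≃+ (ι → ZMod n)) (i : ι) :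
    (stdVec e i : CoeffExtension ℤ A M) = tmul 1 (e.symm (Pi.single i (1 : ZMod n))) := rfl

/-- The coordinates of `1 ⊗ e⁻¹(δ_i)` are `δ_i`. [folklore] -/
private theorem coordOfAddEquiv_stdVec (hn : (n : A) = 0) (e : M ≃+ (ι → ZMod n)) (i : ι) :
    coordOfAddEquiv hn e (stdVec e i) = Pi.single i 1 := by
  ext j
  rw [stdVec_def, coordOfAddEquiv_tmul, e.apply_symm_apply, one_mul, Pi.single_apply, Pi.single_apply]
  by_cases h : j = i
  · rw [if_pos h, if_pos h, ← zmodCastHom_apply hn, map_one]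
  · rw [if_neg h, if_neg h, ZMod.cast_zero]

end Vec

section Basis

variable {A : Type*} [CommRing A] {n : ℕ} {ι : Type*} [Fintype ι] [DecidableEq ι] {M : Type*} [AddCommGroup M]

/-! ## Reconstruction of `x ∈ M` from its coordinates `e(x) ∈ (ℤ/n)^ι` -/

/-- **`x = ∑ i (e(x)_i)~ • e⁻¹(δ_i)`** for an additive isomorphism `e : M ≃ (ℤ/n)^ι` and the integer lifts
`(e(x)_i)~ = cast (e x i) ∈ ℤ`. [folklore] -/
private theorem sum_cast_zsmul_symm_single_eq (e : M ≃+ (ι → ZMod n)) (x : M) :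
    ∑ i, (ZMod.cast (e x i) : ℤ) • e.symm (Pi.single i 1) = x := by
  apply e.injective
  rw [map_sum]
  conv_rhs => rw [← Finset.univ_sum_single (e x)]
  refine Finset.sum_congr rfl fun i _ => ?_
  rw [map_zsmul, e.apply_symm_apply]
  ext j
  rw [Pi.smul_apply, Pi.single_apply, Pi.single_apply]
  split_ifs with h
  · rw [zsmul_eq_mul, mul_one, ZMod.intCast_zmod_cast]
  · rw [smul_zero]

/-! ## The synthesis map `A^ι → A ⊗_ℤ M` and the two compositions -/

/-- **The synthesis map `A^ι →ₗ[A] A ⊗_ℤ M`, `c ↦ ∑ i, c i • (1 ⊗ e⁻¹(δ_i))`** (Mathlib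
`Fintype.linearCombination` on the vectors `1 ⊗ e⁻¹(δ_i)`). [cite: BourbakiAlgebre1a3, Ch. II §5 no. 1 Prop. 4 (a basis (a_λ) of E gives the basis (1 ⊗ a_λ) of ρ^*(E) = B ⊗_A E)] -/
def synthOfAddEquiv (e : M ≃+ (ι → ZMod n)) : (ι → A) →ₗ[A] CoeffExtension ℤ A M :=
  Fintype.linearCombination A (stdVec e)

/-- Unfolding `synthOfAddEquiv`: `c ↦ ∑ i, c i • (1 ⊗ e⁻¹(δ_i))`. [cite: BourbakiAlgebre1a3, Ch. II §5 no. 1 Prop. 4 (a basis (a_λ) of E gives the basis (1 ⊗ a_λ) of ρ^*(E) = B ⊗_A E)] -/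
theorem synthOfAddEquiv_apply (e : M ≃+ (ι → ZMod n)) (c : ι → A) :
    synthOfAddEquiv e c = ∑ i, c i • (stdVec e i : CoeffExtension ℤ A M) :=
  Fintype.linearCombination_apply A (stdVec e) c

/-- `synth (r δ_i) = r • (1 ⊗ e⁻¹(δ_i))`. [folklore] -/
private theorem synthOfAddEquiv_single (e : M ≃+ (ι → ZMod n)) (i : ι) (r : A) :
    synthOfAddEquiv e (Pi.single i r) = r • (stdVec e i : CoeffExtension ℤ A M) :=
  Fintype.linearCombination_apply_single A (stdVec e) i r

/-- `coord ∘ synth = id` on `A^ι`. [folklore] -/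
private theorem coordOfAddEquiv_synthOfAddEquiv (hn : (n : A) = 0) (e : M ≃+ (ι → ZMod n)) (c : ι → A) :
    coordOfAddEquiv hn e (synthOfAddEquiv e c) = c := by
  suffices h : (coordOfAddEquiv hn e).comp (synthOfAddEquiv e) = LinearMap.id from
    LinearMap.congr_fun h c
  refine LinearMap.pi_ext fun i r => ?_
  rw [LinearMap.comp_apply, LinearMap.id_apply, synthOfAddEquiv_single, map_smul, coordOfAddEquiv_stdVec,
    ← Pi.single_smul' i r (1 : A), smul_eq_mul, mul_one]

/-- `synth (coord (a ⊗ x)) = a ⊗ x`: the heart of the matter — `x` is recovered from its coordinates through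
integer lifts (`sum_cast_zsmul_symm_single_eq`) because `n = 0` in `A`. [folklore] -/
private theorem synthOfAddEquiv_coordOfAddEquiv_tmul (hn : (n : A) = 0) (e : M ≃+ (ι → ZMod n)) (a : A) (x : M) :
    synthOfAddEquiv e (coordOfAddEquiv hn e (tmul a x)) = (tmul a x : CoeffExtension ℤ A M) := by
  rw [synthOfAddEquiv_apply]
  have h : ∀ i, coordOfAddEquiv hn e (tmul a x) i • (stdVec e i : CoeffExtension ℤ A M) =
      a • tmul 1 ((ZMod.cast (e x i) : ℤ) • e.symm (Pi.single i 1)) := fun i => by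
    rw [coordOfAddEquiv_tmul, mul_smul, stdVec_def, ← ZMod.intCast_cast, intCast_smul_tmul]
  simp_rw [h]
  rw [← Finset.smul_sum]
  have h2 : ∑ i, (tmul 1 ((ZMod.cast (e x i) : ℤ) • e.symm (Pi.single i 1)) : CoeffExtension ℤ A M) =
      tmul 1 x := by
    simp_rw [← tmulRight_apply]
    rw [← map_sum, sum_cast_zsmul_symm_single_eq e x]
  rw [h2, smul_tmul_one_eq]

/-- `synth ∘ coord = id` on `A ⊗_ℤ M`. [folklore] -/
private theorem synthOfAddEquiv_coordOfAddEquiv (hn : (n : A) = 0) (e : M ≃+ (ι → ZMod n))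
    (y : CoeffExtension ℤ A M) : synthOfAddEquiv e (coordOfAddEquiv hn e y) = y := by
  induction y using CoeffExtension.induction_on with
  | zero => rw [map_zero, map_zero]
  | tmul a x => exact synthOfAddEquiv_coordOfAddEquiv_tmul hn e a x
  | add y z hy hz => rw [map_add, map_add, hy, hz]

/-- **`A ⊗_ℤ M ≃ₗ[A] A^ι`** for `M ≃ (ℤ/n)^ι` additively and `(n : A) = 0` (coordinates / synthesis; Bourbaki:
`A ⊗_ℤ M = A ⊗_{ℤ/n} M` and base change of the free `ℤ/n`-module `M`). [cite: BourbakiAlgebre1a3, Ch. II §3 no. 6 Cor. 3 to Prop. 6 (E ⊗_A F = (E/𝔞E) ⊗_{A/𝔞} F for 𝔞 ⊆ Ann F; Cor. 2: (ℤ/n) ⊗_ℤ F = F/nF)] [cite: BourbakiAlgebre1a3, Ch. II §5 no. 1 Prop. 4 (a basis (a_λ) of E gives the basis (1 ⊗ a_λ) of ρ^*(E) = B ⊗_A E)] -/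
def coordEquivOfAddEquiv (hn : (n : A) = 0) (e : M ≃+ (ι → ZMod n)) : CoeffExtension ℤ A M ≃ₗ[A] (ι → A) :=
  LinearEquiv.ofLinear (coordOfAddEquiv hn e) (synthOfAddEquiv e)
    (LinearMap.ext (coordOfAddEquiv_synthOfAddEquiv hn e))
    (LinearMap.ext (synthOfAddEquiv_coordOfAddEquiv hn e))

/-- Unfolding `coordEquivOfAddEquiv`: it is `coordOfAddEquiv`. [cite: BourbakiAlgebre1a3, Ch. II §5 no. 1 Prop. 4 (a basis (a_λ) of E gives the basis (1 ⊗ a_λ) of ρ^*(E) = B ⊗_A E)] -/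
@[simp]
theorem coordEquivOfAddEquiv_apply (hn : (n : A) = 0) (e : M ≃+ (ι → ZMod n)) (y : CoeffExtension ℤ A M) :
    coordEquivOfAddEquiv hn e y = coordOfAddEquiv hn e y := rfl

/-- The inverse of `coordEquivOfAddEquiv` is `synthOfAddEquiv`. [cite: BourbakiAlgebre1a3, Ch. II §5 no. 1 Prop. 4 (a basis (a_λ) of E gives the basis (1 ⊗ a_λ) of ρ^*(E) = B ⊗_A E)] -/
@[simp]
theorem coordEquivOfAddEquiv_symm_apply (hn : (n : A) = 0) (e : M ≃+ (ι → ZMod n)) (c : ι → A) :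
    (coordEquivOfAddEquiv hn e).symm c = synthOfAddEquiv e c := rfl

/-! ## The basis `i ↦ 1 ⊗ e⁻¹(δ_i)` and Howard's H.0 shape -/

/-- **The `A`-basis `i ↦ 1 ⊗ e⁻¹(δ_i)` of `A ⊗_ℤ M`** attached to an additive isomorphism `e : M ≃ (ℤ/n)^ι`,
when `n = 0` in `A` (Howard 2004 H.0 for `E[p^k] ⊗ A_{m,k}`: `A = A_{m,k}`, `M = E[p^k]`, `ι = Fin 2`).
[cite: BourbakiAlgebre1a3, Ch. II §5 no. 1 Prop. 4 (a basis (a_λ) of E gives the basis (1 ⊗ a_λ) of ρ^*(E) = B ⊗_A E)] [cite: Howard2004HeegnerKolyvagin, §1.3 hypothesis H.0 (arXiv:1202.6340 §2.3, p0007)] -/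
def basisOfAddEquiv (hn : (n : A) = 0) (e : M ≃+ (ι → ZMod n)) : Module.Basis ι A (CoeffExtension ℤ A M) :=
  Module.Basis.ofEquivFun (coordEquivOfAddEquiv hn e)

/-- The basis vectors are `1 ⊗ e⁻¹(δ_i)`. [cite: BourbakiAlgebre1a3, Ch. II §5 no. 1 Prop. 4 (a basis (a_λ) of E gives the basis (1 ⊗ a_λ) of ρ^*(E) = B ⊗_A E)] -/
theorem basisOfAddEquiv_apply (hn : (n : A) = 0) (e : M ≃+ (ι → ZMod n)) (i : ι) :
    basisOfAddEquiv hn e i = (tmul 1 (e.symm (Pi.single i (1 : ZMod n))) : CoeffExtension ℤ A M) := by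
  rw [basisOfAddEquiv, Module.Basis.coe_ofEquivFun]
  change (coordEquivOfAddEquiv hn e).symm (Pi.single i 1) = _
  rw [coordEquivOfAddEquiv_symm_apply, synthOfAddEquiv_single, one_smul, stdVec_def]

/-- Coordinates in the basis: `repr (a ⊗ x) i = a · e(x)_i`. [cite: BourbakiAlgebre1a3, Ch. II §5 no. 1 Prop. 4 (a basis (a_λ) of E gives the basis (1 ⊗ a_λ) of ρ^*(E) = B ⊗_A E)] -/
theorem basisOfAddEquiv_repr_tmul (hn : (n : A) = 0) (e : M ≃+ (ι → ZMod n)) (a : A) (x : M) (i : ι) :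
    (basisOfAddEquiv hn e).repr (tmul a x) i = a * (ZMod.cast (e x i) : A) := by
  rw [basisOfAddEquiv, Module.Basis.ofEquivFun_repr_apply, coordEquivOfAddEquiv_apply, coordOfAddEquiv_tmul]

/-- **`A ⊗_ℤ M` is a free `A`-module** (`M ≃ (ℤ/n)^ι`, `(n : A) = 0`). [cite: BourbakiAlgebre1a3, Ch. II §5 no. 1 Prop. 4 (a basis (a_λ) of E gives the basis (1 ⊗ a_λ) of ρ^*(E) = B ⊗_A E)] [cite: Howard2004HeegnerKolyvagin, §1.3 hypothesis H.0 (arXiv:1202.6340 §2.3, p0007)] -/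
theorem free_of_addEquiv (hn : (n : A) = 0) (e : M ≃+ (ι → ZMod n)) : Module.Free A (CoeffExtension ℤ A M) :=
  Module.Free.of_basis (basisOfAddEquiv hn e)

/-- `A ⊗_ℤ M` is a finitely generated `A`-module (`M ≃ (ℤ/n)^ι`, `(n : A) = 0`; it has a finite basis). [cite: BourbakiAlgebre1a3, Ch. II §5 no. 1 Prop. 4 (a basis (a_λ) of E gives the basis (1 ⊗ a_λ) of ρ^*(E) = B ⊗_A E)] -/
theorem moduleFinite_of_addEquiv (hn : (n : A) = 0) (e : M ≃+ (ι → ZMod n)) :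
    Module.Finite A (CoeffExtension ℤ A M) :=
  Module.Finite.of_basis (basisOfAddEquiv hn e)

/-- **`rank_A (A ⊗_ℤ M) = |ι|`** for `M ≃ (ℤ/n)^ι`, `(n : A) = 0`, `A` non-trivial (Howard's «free of rank
two» at `ι = Fin 2`). [cite: BourbakiAlgebre1a3, Ch. II §5 no. 1 Prop. 4 (a basis (a_λ) of E gives the basis (1 ⊗ a_λ) of ρ^*(E) = B ⊗_A E)] [cite: Howard2004HeegnerKolyvagin, §1.3 hypothesis H.0 (arXiv:1202.6340 §2.3, p0007)] -/
theorem finrank_eq_card_of_addEquiv [Nontrivial A] (hn : (n : A) = 0) (e : M ≃+ (ι → ZMod n)) :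
    Module.finrank A (CoeffExtension ℤ A M) = Fintype.card ι :=
  Module.finrank_eq_card_basis (basisOfAddEquiv hn e)

/-- **`#(A ⊗_ℤ M) = #A ^ |ι|`** for `M ≃ (ℤ/n)^ι`, `(n : A) = 0` (`A ⊗_ℤ M ≅ A^ι`). [cite: BourbakiAlgebre1a3, Ch. II §5 no. 1 Prop. 4 (a basis (a_λ) of E gives the basis (1 ⊗ a_λ) of ρ^*(E) = B ⊗_A E)] -/
theorem natCard_eq_pow_of_addEquiv (hn : (n : A) = 0) (e : M ≃+ (ι → ZMod n)) :
    Nat.card (CoeffExtension ℤ A M) = Nat.card A ^ Fintype.card ι := by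
  rw [Nat.card_congr (coordEquivOfAddEquiv hn e).toEquiv, Nat.card_fun, Nat.card_eq_fintype_card (α := ι)]

/-- `A ⊗_ℤ M` is finite when `A` is (`M ≃ (ℤ/n)^ι`, `(n : A) = 0`; `A ⊗_ℤ M ≅ A^ι`). [cite: BourbakiAlgebre1a3, Ch. II §5 no. 1 Prop. 4 (a basis (a_λ) of E gives the basis (1 ⊗ a_λ) of ρ^*(E) = B ⊗_A E)] -/
theorem finite_of_addEquiv [Finite A] (hn : (n : A) = 0) (e : M ≃+ (ι → ZMod n)) :
    Finite (CoeffExtension ℤ A M) :=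
  Finite.of_equiv _ (coordEquivOfAddEquiv hn e).toEquiv.symm

end Basis

end CoeffExtension

end Literature.NumberTheory.GaloisRepresentations

end
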